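import Mathlib
import Literature.Computability.AlgebraicComplexity.LinSubst
import Summits.ValiantsHypothesis.ValiantsHypothesis.Theorems.BorderApolarityFixedWitnessObstructionQPH0Elementary

/-!
# Border apolarity, crux `ToricFixedPoints` — the three one-parameter families of `H₀(n,m)`

Route `ValiantsHypothesis/BorderApolarity`, crux item `stmt-ValiantsHypothesis-5779`, line
`colon-tower-distraction`, stub `stub_h0Families`.  The stability clause W4 of an `H₀(n,m)`-fixed
point says: every invertible matrix `M` on the `m²` variables `Fin m × Fin m` which is
(i) triangular for the total order `rk` ("own" variables — `ℓ = (0,0)` and the `Y`-block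
`{v | m-n ≤ v.1 ∧ m-n ≤ v.2}` — first, the unused `z`-variables last), (ii) diagonal on the own
columns, (iii) rank-one on the `Y`-diagonal and (iv) of character
`M₀₀^{m-n} · ∏_{block i} M_{(ii)(ii)} = 1`, maps each `J k` (`k ≤ m`) into itself by
`D ↦ linSubst Mᵀ D`.  The line `colon-tower-distraction` consumes three one-parameter families of
such matrices, extracted here:

* (U) `∂_y ↦ ∂_y + c ∂_z` (`y` own, `z` unused, any `c`): the matrix `1 + c • single z y 1` is the
  transpose of the transvection `1 + single y z c` — this is literally the first family of the
  sibling line's `stub_h0Elementary`, which we reuse;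
* (B) `∂_z ↦ ∂_z + c ∂_{z'}` (`z ≠ z'` both unused, `rk z ≤ rk z'`): the matrix
  `1 + c • single z' z 1` is the transpose of the transvection `1 + single z z' c`; its only
  off-diagonal entry sits at `(z, z')`, allowed by (i) exactly because `rk z ≤ rk z'`; the column
  `z'` is unused so (ii) is vacuous there; all diagonal entries are `1`, so (iii), (iv) hold and
  `det = 1`;
* (T) the torus `diagonal d`, `d v ≠ 0` for all `v`: symmetric and diagonal (so (i), (ii) hold),
  and (iii), (iv) are literally the hypotheses on `d`; `det = ∏ d v ≠ 0`.

Pure bookkeeping: exhibit the matrix as an element of `GL` via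
`Matrix.GeneralLinearGroup.mkOfDetNeZero` and check the four clauses against the `if`-defined
order `rk`.
-/

set_option linter.dupNamespace false

open MvPolynomial Filter
open scoped BigOperators Matrix
open Literature.Computability.AlgebraicComplexity
open Summit.ValiantsHypothesis.ValiantsHypothesis.Theorems.BorderApolarityFixedWitnessObstructionQP

namespace Summit.ValiantsHypothesis.ValiantsHypothesis.Theorems.BorderApolarityToricFixedPoints

/-- **The three one-parameter families of `H₀(n,m)` (W4 ⇒ (U) ∧ (B) ∧ (T)).**
From the stability clause W4 (every invertible `M` that is triangular for the `rk` order "own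
variables first, unused last", diagonal on the own columns, rank-one on the `Y`-diagonal and of
character `M₀₀^{m-n} ∏ M_{(ii)(ii)} = 1` maps `J k` into itself by `D ↦ linSubst Mᵀ D`, `k ≤ m`) we get
stability of each `J k`, `k ≤ m`, under
(U) `linSubst (1 + c • single z y 1)` (`y` own, `z` unused, any `c`; `M = transvection y z c`),
(B) `linSubst (1 + c • single z' z 1)` (`z ≠ z'` unused, `rk z ≤ rk z'`, any `c`;
`M = transvection z z' c`: the entry `(z, z')` is allowed since `rk z ≤ rk z'`, own columns stay
diagonal because `z'` is unused, all diagonal entries are `1`, `det M = 1`), and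
(T) `linSubst (diagonal d)` for every nowhere-vanishing `d` satisfying the rank-one and character
conditions (symmetric, diagonal, `det = ∏ d v ≠ 0`). [folklore] -/
theorem stub_h0Families (n m : ℕ) [NeZero m] (J : ℕ → Set (MvPolynomial (Fin m × Fin m) ℂ))
    (hW4 : ∀ A : Matrix.GeneralLinearGroup (Fin m × Fin m) ℂ,
      let M : Matrix (Fin m × Fin m) (Fin m × Fin m) ℂ := A
      let rk := fun (p : Fin m × Fin m) =>
        (if (m - n ≤ (p.1 : ℕ) ∧ m - n ≤ (p.2 : ℕ)) ∨ p = (0, 0) then 0 else m * m) + ((p.1 : ℕ) * m + (p.2 : ℕ))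
      (∀ i j : Fin m × Fin m, M j i ≠ 0 → rk j ≤ rk i) →
      (∀ i j : Fin m × Fin m, ((m - n ≤ (i.1 : ℕ) ∧ m - n ≤ (i.2 : ℕ)) ∨ i = (0, 0)) → j ≠ i → M j i = 0) →
      (∀ i k j l : Fin m, m - n ≤ (i : ℕ) → m - n ≤ (k : ℕ) → m - n ≤ (j : ℕ) → m - n ≤ (l : ℕ) →
        M (i, j) (i, j) * M (k, l) (k, l) = M (i, l) (i, l) * M (k, j) (k, j)) →
      M (0, 0) (0, 0) ^ (m - n) * ∏ i ∈ Finset.univ.filter (fun i : Fin m => m - n ≤ (i : ℕ)), M (i, i) (i, i) = 1 →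
      ∀ k ≤ m, ∀ D ∈ J k, linSubst (Fin m × Fin m) ℂ Mᵀ D ∈ J k) :
    (∀ y z : Fin m × Fin m,
        ((m - n ≤ (y.1 : ℕ) ∧ m - n ≤ (y.2 : ℕ)) ∨ y = (0, 0)) →
        ¬ ((m - n ≤ (z.1 : ℕ) ∧ m - n ≤ (z.2 : ℕ)) ∨ z = (0, 0)) →
        ∀ c : ℂ, ∀ k ≤ m, ∀ D ∈ J k,
          linSubst (Fin m × Fin m) ℂ (1 + c • Matrix.single z y (1 : ℂ)) D ∈ J k) ∧
    (∀ z z' : Fin m × Fin m,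
        ¬ ((m - n ≤ (z.1 : ℕ) ∧ m - n ≤ (z.2 : ℕ)) ∨ z = (0, 0)) →
        ¬ ((m - n ≤ (z'.1 : ℕ) ∧ m - n ≤ (z'.2 : ℕ)) ∨ z' = (0, 0)) → z ≠ z' →
        (if (m - n ≤ (z.1 : ℕ) ∧ m - n ≤ (z.2 : ℕ)) ∨ z = (0, 0) then 0 else m * m) + ((z.1 : ℕ) * m + (z.2 : ℕ)) ≤
          (if (m - n ≤ (z'.1 : ℕ) ∧ m - n ≤ (z'.2 : ℕ)) ∨ z' = (0, 0) then 0 else m * m) +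
            ((z'.1 : ℕ) * m + (z'.2 : ℕ)) →
        ∀ c : ℂ, ∀ k ≤ m, ∀ D ∈ J k,
          linSubst (Fin m × Fin m) ℂ (1 + c • Matrix.single z' z (1 : ℂ)) D ∈ J k) ∧
    (∀ d : Fin m × Fin m → ℂ, (∀ v, d v ≠ 0) →
        (∀ i k j l : Fin m, m - n ≤ (i : ℕ) → m - n ≤ (k : ℕ) → m - n ≤ (j : ℕ) → m - n ≤ (l : ℕ) →
          d (i, j) * d (k, l) = d (i, l) * d (k, j)) →
        d (0, 0) ^ (m - n) * ∏ i ∈ Finset.univ.filter (fun i : Fin m => m - n ≤ (i : ℕ)), d (i, i) = 1 →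
        ∀ k ≤ m, ∀ D ∈ J k, linSubst (Fin m × Fin m) ℂ (Matrix.diagonal d) D ∈ J k) := by
  refine ⟨?_, ?_, ?_⟩
  · -- Family (U): `∂_y ↦ ∂_y + c ∂_z`, the first family of the sibling line's `stub_h0Elementary`.
    intro y z hy hz c k hk D hD
    exact (stub_h0Elementary n m J hW4 k hk).1 y z hy hz c D hD
  · -- Family (B): `∂_z ↦ ∂_z + c ∂_{z'}`, the transpose of the transvection `1 + single z z' c`.
    intro z z' _hz hz' hzz' hrk c k hk D hD
    have hT : (1 + c • Matrix.single z' z (1 : ℂ)) = (Matrix.transvection z z' c)ᵀ := by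
      rw [Matrix.transvection, Matrix.transpose_add, Matrix.transpose_one, Matrix.transpose_single,
        Matrix.smul_single, smul_eq_mul, mul_one]
    have hdet : (Matrix.transvection z z' c).det ≠ 0 := by
      rw [Matrix.det_transvection_of_ne _ _ hzz']
      exact one_ne_zero
    -- all diagonal entries of the transvection are `1`
    have hdiag : ∀ p, Matrix.transvection z z' c p p = 1 := fun p => by
      rw [Matrix.transvection, Matrix.add_apply, Matrix.one_apply_eq, Matrix.single_apply,
        if_neg (fun h => hzz' (h.1.trans h.2.symm)), add_zero]
    have h := hW4 (Matrix.GeneralLinearGroup.mkOfDetNeZero _ hdet)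
    simp only [Matrix.GeneralLinearGroup.val_mkOfDetNeZero] at h
    rw [hT]
    refine h ?_ ?_ ?_ ?_ k hk D hD
    · -- (i) triangularity for `rk`: the only off-diagonal entry is `(z, z')`, and `rk z ≤ rk z'`
      intro i j hij
      by_cases hji : j = i
      · subst hji
        exact le_rfl
      · rw [Matrix.transvection, Matrix.add_apply, Matrix.one_apply_ne hji, zero_add,
          Matrix.single_apply] at hij
        by_cases hzj : z = j ∧ z' = i
        · obtain ⟨rfl, rfl⟩ := hzj
          exact hrk
        · exact (hij (if_neg hzj)).elim
    · -- (ii) own columns are diagonal: an entry `(j, i) = (z, z')` would make `z' = i` own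
      intro i j hi hji
      rw [Matrix.transvection, Matrix.add_apply, Matrix.one_apply_ne hji, zero_add,
        Matrix.single_apply, if_neg]
      rintro ⟨-, rfl⟩
      exact hz' hi
    · -- (iii) rank-one pattern on the `Y`-diagonal: all diagonal entries are `1`
      intro i k' j l _ _ _ _
      simp only [hdiag]
    · -- (iv) character `1`
      simp only [hdiag, one_pow, one_mul, Finset.prod_const_one]
  · -- Family (T): the torus `diagonal d`, `d` nowhere zero.
    intro d hd hrk1 hchar k hk D hD
    have hdet : (Matrix.diagonal d).det ≠ 0 := by
      rw [Matrix.det_diagonal]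
      exact Finset.prod_ne_zero_iff.mpr fun v _ => hd v
    have h := hW4 (Matrix.GeneralLinearGroup.mkOfDetNeZero _ hdet)
    simp only [Matrix.GeneralLinearGroup.val_mkOfDetNeZero, Matrix.diagonal_transpose] at h
    refine h ?_ ?_ ?_ ?_ k hk D hD
    · -- (i) diagonal matrices are triangular
      intro i j hij
      by_cases hji : j = i
      · subst hji
        exact le_rfl
      · exact (hij (Matrix.diagonal_apply_ne _ hji)).elim
    · -- (ii) diagonal
      intro i j _ hji
      exact Matrix.diagonal_apply_ne _ hji
    · -- (iii) the rank-one pattern on the `Y`-diagonal is the hypothesis on `d`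
      intro i k' j l hi hk' hj hl
      simp only [Matrix.diagonal_apply_eq]
      exact hrk1 i k' j l hi hk' hj hl
    · -- (iv) the character condition is the hypothesis on `d`
      simp only [Matrix.diagonal_apply_eq]
      exact hchar

end Summit.ValiantsHypothesis.ValiantsHypothesis.Theorems.BorderApolarityToricFixedPoints
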